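import Mathlib
import Summits.ValiantsHypothesis.ValiantsHypothesis.Theorems.TwoProducts.Negative.CommonPadding
import HarnessLib

/-!
# NEGATIVE lane (val-neg-1 g5): DILATION `X ↦ X^N` is an automorphism of the cell count

Helper file for crux `stmt-ValiantsHypothesis-5906` (filed `--supports`; closes NO item, proves NO summit statement, does NOT prove
`TwoProducts`, `PlanarCellBound`, `CellLaw`, `HugeCapCellLaw`, any `ResidualLawV…` or VP ≠ VNP; 0 `def`s).

Scaling all exponents by `N ≥ 1` (`MvPolynomial.expand N`, i.e. `u_j(X₁, X₂) ↦ u_j(X₁^N, X₂^N)`) keeps the normalisation and the sparsity `t`,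
multiplies `logSupport`, `tailSupport` and every supporting line by `N`, keeps the valid weights, and transports every cell family `S` (with the
SAME witnesses) to the cell family `N • S` of the same cardinality.  Used in `Negative/HugeCapResidual.lean` (idea-34's cap manufacture K3 in
kernel form).  Mathlib ingredients: `coeff_expand_smul`, `coeff_expand_zero`, `support_expand`, `support_expand_subset`.  [folklore]
-/

namespace Summit.ValiantsHypothesis.Theorems.TwoProducts.Negative.Dilation

open Finset MvPolynomial
open Summit.ValiantsHypothesis.ValiantsHypothesis.Theorems.NewtonUnitEquations.TwoProducts.FormalLogLinearisation
open Summit.ValiantsHypothesis.ValiantsHypothesis.Theorems.NewtonUnitEquations.TwoProducts.PlanarCell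
open Summit.ValiantsHypothesis.Theorems.TwoProducts.Negative.CommonPadding

variable {m N : ℕ}

/-! ### Scalar multiples of exponents -/

/-- `N • ·` is injective on exponents for `N ≥ 1`. [folklore] -/
theorem nsmul_right_cancel (hN : 0 < N) {a b : Expo} (h : N • a = N • b) : a = b := by
  ext i
  have := DFunLike.congr_fun h i
  simp only [Finsupp.smul_apply, smul_eq_mul] at this
  exact Nat.eq_of_mul_eq_mul_left hN this

/-- Undoing the dilation coordinatewise. [folklore] -/
theorem mapRange_div_nsmul (hN : 0 < N) (e : Expo) :
    Finsupp.mapRange (fun k : ℕ => k / N) (by simp) (N • e) = e := by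
  ext i
  simp only [Finsupp.mapRange_apply, Finsupp.smul_apply, smul_eq_mul, Nat.mul_div_cancel_left _ hN]

/-- Cardinality is kept. [folklore] -/
theorem card_image_nsmul (hN : 0 < N) (S : Finset Expo) : (S.image fun e => N • e).card = S.card :=
  Finset.card_image_of_injective _ fun _ _ h => nsmul_right_cancel hN h

/-- Strict weight comparisons are kept under dilation. [folklore] -/
theorem wt_nsmul_lt_iff (hN : 0 < N) (ξ : Fin 2 → ℝ) (a b : Expo) : wt ξ (N • a) < wt ξ (N • b) ↔ wt ξ a < wt ξ b := by
  have hNr : (0 : ℝ) < N := by exact_mod_cast hN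
  rw [wt_nsmul, wt_nsmul]
  constructor
  · intro h
    by_contra h'
    push Not at h'
    nlinarith [mul_le_mul_of_nonneg_left h' hNr.le]
  · intro h
    nlinarith [mul_lt_mul_of_pos_left h hNr]

/-- Weak weight comparisons are kept under dilation. [folklore] -/
theorem wt_nsmul_le_iff (hN : 0 < N) (ξ : Fin 2 → ℝ) (a b : Expo) : wt ξ (N • a) ≤ wt ξ (N • b) ↔ wt ξ a ≤ wt ξ b := by
  rw [← not_lt, wt_nsmul_lt_iff hN, not_lt]

/-- Negativity is kept under dilation. [folklore] -/
theorem wt_nsmul_neg_iff (hN : 0 < N) (ξ : Fin 2 → ℝ) (a : Expo) : wt ξ (N • a) < 0 ↔ wt ξ a < 0 := by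
  have := wt_nsmul_lt_iff hN ξ a 0
  rwa [smul_zero, wt_zero] at this

/-! ### Powers of a normalised polynomial start in degree `r` -/

/-- Every monomial of `p ^ r` has total degree `≥ r` when `p` has no constant term. [folklore] -/
theorem le_deg_of_mem_support_pow (p : MvPolynomial (Fin 2) ℂ) (hp : coeff 0 p = 0) :
    ∀ (r : ℕ), ∀ b ∈ (p ^ r).support, r ≤ b 0 + b 1 := by
  classical
  intro r
  induction r with
  | zero => intro b _; simp
  | succ r ih =>
    intro b hb
    rw [pow_succ] at hb
    obtain ⟨a, ha, c, hc, rfl⟩ := Finset.mem_add.1 (support_mul _ _ hb)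
    have hc0 : c ≠ 0 := by
      rintro rfl
      exact (mem_support_iff.1 hc) hp
    have hc1 : 1 ≤ c 0 + c 1 := by
      by_contra h
      push Not at h
      apply hc0
      ext i
      fin_cases i <;> simp <;> omega
    have := ih a ha
    simp only [Finsupp.add_apply]
    omega

/-- Hence `coeff n (p ^ r) = 0` for `r > |n|`. [folklore] -/
theorem coeff_pow_eq_zero_of_lt (p : MvPolynomial (Fin 2) ℂ) (hp : coeff 0 p = 0) {r : ℕ} {n : Expo}
    (h : n 0 + n 1 < r) : coeff n (p ^ r) = 0 := by
  classical
  by_contra hne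
  have := le_deg_of_mem_support_pow p hp r n (mem_support_iff.2 hne)
  omega

/-- The truncation range of `logCoeff` may be enlarged. [folklore] -/
theorem logCoeff_eq_sum_Icc (p : MvPolynomial (Fin 2) ℂ) (hp : coeff 0 p = 0) (n : Expo) {K : ℕ} (hK : n 0 + n 1 ≤ K) :
    logCoeff p n = ∑ r ∈ Finset.Icc 1 K, (-1 : ℂ) ^ (r + 1) / (r : ℂ) * coeff n (p ^ r) := by
  unfold logCoeff
  apply Finset.sum_subset (Finset.Icc_subset_Icc le_rfl hK)
  intro r hr hr'
  simp only [Finset.mem_Icc, not_and, not_le] at hr hr'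
  rw [coeff_pow_eq_zero_of_lt p hp (hr' hr.1), mul_zero]

/-! ### `logCoeff`, `logDiff`, `logSupport` under dilation -/

/-- On the dilated lattice `logCoeff` is transported. [folklore] -/
theorem logCoeff_expand_nsmul (hN : N ≠ 0) (p : MvPolynomial (Fin 2) ℂ) (hp : coeff 0 p = 0) (n : Expo) :
    logCoeff (expand N p) (N • n) = logCoeff p n := by
  have hle : n 0 + n 1 ≤ (N • n) 0 + (N • n) 1 := by
    simp only [Finsupp.smul_apply, smul_eq_mul]
    have h1 : 1 ≤ N := Nat.one_le_iff_ne_zero.2 hN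
    nlinarith
  rw [logCoeff_eq_sum_Icc p hp n hle]
  unfold logCoeff
  refine Finset.sum_congr rfl fun r _ => ?_
  rw [← map_pow, coeff_expand_smul _ hN]

/-- Off the dilated lattice `logCoeff` vanishes. [folklore] -/
theorem logCoeff_expand_eq_zero (p : MvPolynomial (Fin 2) ℂ) (n : Expo) (h : ∀ n₀ : Expo, n ≠ N • n₀) :
    logCoeff (expand N p) n = 0 := by
  classical
  unfold logCoeff
  refine Finset.sum_eq_zero fun r _ => ?_
  rw [← map_pow]
  have : n ∉ (expand N (p ^ r)).support := by
    intro hmem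
    obtain ⟨a, -, ha⟩ := Finset.mem_image.1 (support_expand_subset (p ^ r) hmem)
    exact h a ha.symm
  rw [notMem_support_iff.1 this, mul_zero]

/-- `logDiff` on the dilated lattice. [folklore] -/
theorem logDiff_expand_nsmul (hN : N ≠ 0) (u v : Fin m → MvPolynomial (Fin 2) ℂ)
    (hu0 : ∀ j, coeff 0 (u j) = 0) (hv0 : ∀ j, coeff 0 (v j) = 0) (n : Expo) :
    logDiff (fun j => expand N (u j)) (fun j => expand N (v j)) (N • n) = logDiff u v n := by
  unfold logDiff
  simp only [logCoeff_expand_nsmul hN _ (hu0 _), logCoeff_expand_nsmul hN _ (hv0 _)]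

/-- `logDiff` off the dilated lattice. [folklore] -/
theorem logDiff_expand_eq_zero (u v : Fin m → MvPolynomial (Fin 2) ℂ) (n : Expo) (h : ∀ n₀ : Expo, n ≠ N • n₀) :
    logDiff (fun j => expand N (u j)) (fun j => expand N (v j)) n = 0 := by
  unfold logDiff
  simp only [logCoeff_expand_eq_zero _ n h, Finset.sum_const_zero, sub_zero]

/-- **`logSupport` of the dilated pair is the dilated `logSupport`.** [folklore] -/
theorem logSupport_expand (hN : N ≠ 0) (u v : Fin m → MvPolynomial (Fin 2) ℂ)
    (hu0 : ∀ j, coeff 0 (u j) = 0) (hv0 : ∀ j, coeff 0 (v j) = 0) :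
    logSupport (fun j => expand N (u j)) (fun j => expand N (v j)) = (fun e => N • e) '' logSupport u v := by
  ext n
  simp only [logSupport, Set.mem_setOf_eq, Set.mem_image]
  constructor
  · intro hn
    by_cases h : ∃ n₀ : Expo, n = N • n₀
    · obtain ⟨n₀, rfl⟩ := h
      exact ⟨n₀, by rwa [logDiff_expand_nsmul hN u v hu0 hv0] at hn, rfl⟩
    · push Not at h
      exact absurd (logDiff_expand_eq_zero u v n h) hn
  · rintro ⟨n₀, hn₀, rfl⟩
    rwa [logDiff_expand_nsmul hN u v hu0 hv0]

/-! ### Supports, normalisation, valid weights, strict tops -/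

/-- **`tailSupport` of the dilated pair is the dilated `tailSupport`.** [folklore] -/
theorem tailSupport_expand (hN : N ≠ 0) (u v : Fin m → MvPolynomial (Fin 2) ℂ) :
    tailSupport (fun j => expand N (u j)) (fun j => expand N (v j)) = (tailSupport u v).image fun e => N • e := by
  classical
  unfold tailSupport
  simp only [support_expand _ hN]
  rw [Finset.image_union, Finset.biUnion_image, Finset.biUnion_image]

/-- **Normalisation and sparsity are kept.** [folklore] -/
theorem norm_expand (hN : N ≠ 0) {t : ℕ} (u : Fin m → MvPolynomial (Fin 2) ℂ)
    (hu : ∀ j, coeff 0 (u j) = 0 ∧ (u j).support.card ≤ t) :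
    ∀ j, coeff 0 (expand N (u j)) = 0 ∧ (expand N (u j)).support.card ≤ t := by
  classical
  intro j
  refine ⟨by rw [coeff_expand_zero _ hN]; exact (hu j).1, ?_⟩
  rw [support_expand _ hN]
  exact Finset.card_image_le.trans (hu j).2

/-- **Valid weights are kept.** [folklore] -/
theorem validWeight_expand_iff (hN : 0 < N) (u v : Fin m → MvPolynomial (Fin 2) ℂ) (ξ : Fin 2 → ℝ) :
    ValidWeight (fun j => expand N (u j)) (fun j => expand N (v j)) ξ ↔ ValidWeight u v ξ := by
  classical
  unfold ValidWeight
  simp only [support_expand _ hN.ne', Finset.forall_mem_image, wt_nsmul_neg_iff hN]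

/-- **Strict tops are transported.** [folklore] -/
theorem isStrictTop_nsmul_iff (hN : 0 < N) (ξ : Fin 2 → ℝ) (L : Set Expo) (l : Expo) :
    IsStrictTop ξ ((fun e => N • e) '' L) (N • l) ↔ IsStrictTop ξ L l := by
  unfold IsStrictTop
  constructor
  · rintro ⟨hl, hlt⟩
    obtain ⟨l₀, hl₀, hl₀'⟩ := hl
    have : l₀ = l := nsmul_right_cancel hN hl₀'
    subst this
    refine ⟨hl₀, fun μ hμ hne => ?_⟩
    have h := hlt (N • μ) ⟨μ, hμ, rfl⟩ (fun h => hne (nsmul_right_cancel hN h))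
    exact (wt_nsmul_lt_iff hN ξ μ l₀).1 h
  · rintro ⟨hl, hlt⟩
    refine ⟨⟨l, hl, rfl⟩, ?_⟩
    rintro μ ⟨μ₀, hμ₀, rfl⟩ hne
    have : μ₀ ≠ l := fun h => hne (by rw [h])
    exact (wt_nsmul_lt_iff hN ξ μ₀ l).2 (hlt μ₀ hμ₀ this)

/-! ### Cells are transported with the same witnesses -/

/-- **Pointwise transport of a cell witness**: a weight `ξ` witnessing `l` in the cell of `(u, v)` with order `R` witnesses `N • l` in the
cell of the dilated pair with the transported order. [folklore] -/
theorem cellWitness_expand (hN : 0 < N) (u v : Fin m → MvPolynomial (Fin 2) ℂ)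
    (hu0 : ∀ j, coeff 0 (u j) = 0) (hv0 : ∀ j, coeff 0 (v j) = 0) (R : Expo → Expo → Prop) {l : Expo} {ξ : Fin 2 → ℝ}
    (hval : ValidWeight u v ξ) (htop : IsStrictTop ξ (logSupport u v) l)
    (hR : ∀ e ∈ tailSupport u v, ∀ e' ∈ tailSupport u v, (R e e' ↔ wt ξ e ≤ wt ξ e')) :
    ValidWeight (fun j => expand N (u j)) (fun j => expand N (v j)) ξ ∧
    IsStrictTop ξ (logSupport (fun j => expand N (u j)) (fun j => expand N (v j))) (N • l) ∧
    ∀ e ∈ tailSupport (fun j => expand N (u j)) (fun j => expand N (v j)),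
      ∀ e' ∈ tailSupport (fun j => expand N (u j)) (fun j => expand N (v j)),
        (R (Finsupp.mapRange (fun k : ℕ => k / N) (by simp) e) (Finsupp.mapRange (fun k : ℕ => k / N) (by simp) e') ↔
          wt ξ e ≤ wt ξ e') := by
  refine ⟨(validWeight_expand_iff hN u v ξ).2 hval, ?_, ?_⟩
  · rw [logSupport_expand hN.ne' u v hu0 hv0]
    exact (isStrictTop_nsmul_iff hN ξ _ l).2 htop
  · intro e he e' he'
    rw [tailSupport_expand hN.ne', Finset.mem_image] at he he'
    obtain ⟨e₀, he₀, rfl⟩ := he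
    obtain ⟨e₀', he₀', rfl⟩ := he'
    rw [mapRange_div_nsmul hN, mapRange_div_nsmul hN, hR e₀ he₀ e₀' he₀', wt_nsmul_le_iff hN]

/-- **Cell families are transported**: `S ↦ N • S`, same cardinality. [folklore] -/
theorem isCellFamily_expand (hN : 0 < N) (u v : Fin m → MvPolynomial (Fin 2) ℂ)
    (hu0 : ∀ j, coeff 0 (u j) = 0) (hv0 : ∀ j, coeff 0 (v j) = 0) (R : Expo → Expo → Prop) (S : Finset Expo)
    (hS : IsCellFamily u v R S) :
    IsCellFamily (fun j => expand N (u j)) (fun j => expand N (v j))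
      (fun x y => R (Finsupp.mapRange (fun k : ℕ => k / N) (by simp) x) (Finsupp.mapRange (fun k : ℕ => k / N) (by simp) y))
      (S.image fun e => N • e) := by
  intro l' hl'
  obtain ⟨l, hl, rfl⟩ := Finset.mem_image.1 hl'
  obtain ⟨ξ, hval, htop, hR⟩ := hS l hl
  exact ⟨ξ, cellWitness_expand hN u v hu0 hv0 R hval htop hR⟩

end Summit.ValiantsHypothesis.Theorems.TwoProducts.Negative.Dilation
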